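import Mathlib
import HarnessLib
import Summits.HubbardSuperconductivity.HubbardSuperconductivity.Theses.SeamInduction

/-!
# Disproof of `SeamGluingLocality` — findings (cdisprove seat, crux stmt-HubbardSuperconductivity-18509)

Crux `C := Theses.SeamInduction.SeamGluingLocality` (route SeamInduction): for every `U > 0`,
`δ ∈ (0, 3/10)` there are `M₂, L₂` such that for all even `L ≥ L₂`, even `M′, M″ ≥ M₂`,
`M = M′ + M″ ≤ L`, all labellings:
(1) `(1 − M₂/M)·(min stiff′ stiff″)₊ ≤ stiff_M`, (2) `(1 − M₂/M)·(min icomp′ icomp″)₊ ≤ icomp_M`,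
(3) `icomp_M ≤ (1 + M₂/M)·(max icomp′ icomp″)₊`.

## Findings (index)

* §0 `locality_arith` — the arithmetic skeleton of (1)–(3) at one gluing (`a = M₂/M ≤ 1/2`).
* §1 `seamGluingLocality_hidden` (sorry-free) — HIDDEN UNIVERSAL CONTENT of C: at EVERY point of
  the window, eventually in the sizes, on ALL glued even tubes: `0 ≤ stiff_M`, `0 ≤ icomp_M`
  (unconditional sign claims — first flagged in the refuters' `SeamNonneg.lean`), EXACT DEGENERACY
  `icomp′ ≤ 0 → icomp″ ≤ 0 → icomp_M = 0` (prover's `SeamHiddenClaims.lean`), HEREDITY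
  `min > 0 → min/2 ≤ glued` for both responses and the DOUBLING CEILING `icomp_M ≤ 2·(max)₊`.
* §2 THE KILL MENU (sorry-free `C`-negations modulo a cofinal family at ONE point `(U,δ)` of
  `(0,∞) × (0,3/10)`; each hypothesis is a precise `Prop` with the crux's verbatim let-prefix):
  `seamGluingLocality_false_of_cofinalParamagnet` (glued tubes of width `2m` with `E(π/3) < E(0)`),
  `…_false_of_cofinalConcave` (`Δ²_N E < 0`), `…_false_of_exactDegeneracyFailure`
  (parts with `icomp ≤ 0`, glued tube with `icomp ≠ 0`), `…_false_of_softDoubling`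
  (`0 < stiff_m`, `stiff_{2m} < stiff_m/2` — the planner's CEX/stripe kill scenario, typed),
  `…_false_of_icompJump` (`0 < icomp_m` and `icomp_{2m} ∉ [icomp_m/2, 3 icomp_m/2]`), and its
  corollary `…_false_of_uniformPairGap` (strategist's `NegativeGapExtensivity`: a width-uniform
  pair charge gap makes `icomp = LM·Δ²E/4` EXTENSIVE, ratio → 2 on doubling).
  None of these H is constructible in the tree: each is a ground-state phase-diagram statement
  about arbitrarily large doped Hubbard tubes (see §5).
* §3 LOAD-BEARING HYPOTHESES (`C` with one hypothesis dropped ⇒ strengthening of `C`):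
  `SeamGluingLocalityFromZeroU` (`U = 0` admitted) and `SeamGluingLocalityAllSizes`
  (no thresholds `M₂ = L₂ = 0`) with `…_imp` lemmas (they imply `C`) and NEAR-MISS negations
  (`sorry`, evidence in the docstrings: free-fermion scan / ED job ids).
* §4 TIGHTNESS of the factor: `constantFactor_admits_decay` — replacing `1 − M₂/M` by any
  constant factor (here `1/2`) admits the decaying profile `ρ_M = 1/(M+1)`, so no such weakening
  of `C` can feed a width-uniform floor (the defect of the factor must be summable along the
  merge tree; `1 − M₂/M` along dyadic widths is).
* §5 WHY `C` RESISTS AN UNCONDITIONAL DISPROOF (docstring of `resists`).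
* `-- Targets`: none yet (no lead / no registered skeleton; `Lines/seam_flow.lean` stubs are for
  the restated additive crux).

All prose is in docstrings; everything outside §3's two near-misses is `sorry`-free.

LANDED (importable by ideators / planners / the lead):
* `Summits.HubbardSuperconductivity.HubbardSuperconductivity.Theorems.SeamGluingLocality.Negative.HiddenClaims`
  (p146712, commit c8fd7f8dc242): `locality_arith`, `jump_arith`, `seamGluingLocality_hidden` (= §0–§1);
* `Summits.HubbardSuperconductivity.HubbardSuperconductivity.Theorems.SeamGluingLocality.Negative.KillMenu`
  (p148366, commit cab75d91399c): the six `seamGluingLocality_false_of_…` lemmas (= §2).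
This workfile keeps its own copies (namespace `…Cruxes.SeamGluingLocality.Disproof`) so that it
elaborates stand-alone on the farm.
-/

namespace Summit.HubbardSuperconductivity.HubbardSuperconductivity.Cruxes.SeamGluingLocality.Disproof

open scoped BigOperators Topology Manifold Classical MeasureTheory ProbabilityTheory Matrix InnerProductSpace ComplexConjugate ContinuousMap
open Filter Set Function TopologicalSpace MeasureTheory
open Literature.Hubbard
open Summit.HubbardSuperconductivity.HubbardSuperconductivity.Theses.SeamInduction

/-! ## §0 Arithmetic skeleton of one gluing -/

/-- The three crux inequalities at one gluing, with boundary parameter `a = M₂/M ∈ [0, 1/2]`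
(`M₂ ≤ M′, M″` forces `2M₂ ≤ M`), already imply: signs of the glued responses, exact degeneracy
when both parts are unstable, heredity of positive minima with factor `1/2`, and the doubling
ceiling with factor `2`. [folklore] -/
theorem locality_arith {a s s' s'' c c' c'' : ℝ} (ha0 : 0 ≤ a) (ha : a ≤ 1 / 2)
    (h1 : (1 - a) * max (min s' s'') 0 ≤ s) (h2 : (1 - a) * max (min c' c'') 0 ≤ c)
    (h3 : c ≤ (1 + a) * max (max c' c'') 0) :
    0 ≤ s ∧ 0 ≤ c ∧ (c' ≤ 0 → c'' ≤ 0 → c = 0) ∧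
      (0 < min s' s'' → min s' s'' / 2 ≤ s) ∧ (0 < min c' c'' → min c' c'' / 2 ≤ c) ∧
      c ≤ 2 * max (max c' c'') 0 := by
  have hf0 : (0 : ℝ) ≤ 1 - a := by linarith
  have hs : 0 ≤ s := le_trans (mul_nonneg hf0 (le_max_right _ _)) h1
  have hc : 0 ≤ c := le_trans (mul_nonneg hf0 (le_max_right _ _)) h2
  refine ⟨hs, hc, ?_, ?_, ?_, ?_⟩
  · intro h' h''
    have hz : max (max c' c'') 0 = 0 := max_eq_right (max_le h' h'')
    rw [hz, mul_zero] at h3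
    exact le_antisymm h3 hc
  · intro hpos
    rw [max_eq_left hpos.le] at h1
    nlinarith
  · intro hpos
    rw [max_eq_left hpos.le] at h2
    nlinarith
  · have hm : 0 ≤ max (max c' c'') 0 := le_max_right _ _
    nlinarith

/-- Arithmetic of Kill 5: with `a ≤ 1/2`, a positive part value `x` and the glued value `c`
squeezed by (2)–(3), `c` lies in `[x/2, 3x/2]`. [folklore] -/
theorem jump_arith {a c x : ℝ} (ha : a ≤ 1 / 2) (hpos : 0 < x)
    (h2 : (1 - a) * max x 0 ≤ c) (h3 : c ≤ (1 + a) * max x 0) :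
    ¬ (c < x / 2 ∨ 3 / 2 * x < c) := by
  rw [max_eq_left hpos.le] at h2 h3
  rintro (h | h) <;> nlinarith

/-! ## §1 Hidden universal content of the crux -/

/-- **Hidden universal claims of `SeamGluingLocality`.** For EVERY `U > 0` and `δ ∈ (0,3/10)`
(not only at the witness point where `closes` consumes the crux) there are `M₂, L₂` such that for
all admissible gluings: (i) `0 ≤ stiff_M` and (ii) `0 ≤ icomp_M` — UNCONDITIONAL sign claims on
every wide glued even tube (`E(π/3) ≥ E(0)`: no paramagnetic tube; `Δ²_N E ≥ 0`: no concave
even-`N` staircase), although the informal text says "nothing is claimed from paramagnetic or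
unstable parts"; (iii) EXACT DEGENERACY `icomp′ ≤ 0 → icomp″ ≤ 0 → icomp_M = 0`; (iv), (v)
heredity of positive minima with the absolute factor `1/2`; (vi) doubling ceiling with factor `2`.
(i)–(ii) re-derive the refuters' `SeamNonneg.lean`, (iii) the prover's `SeamHiddenClaims.lean`
(evidence files on the item); typed here over the verbatim let-prefix so that the `false_of`
lemmas of §2 are one-liners. [folklore] -/
theorem seamGluingLocality_hidden (h : SeamGluingLocality) :
    open Matrix Literature.MathematicalPhysics.QuantumLattice in let H0 : ∀ (L M : ℕ) (Λ : Type) [LinearOrder Λ] [Fintype Λ], (Λ ≃ ZMod L × ZMod M) → ℝ → Matrix (Finset (Orb Λ)) (Finset (Orb Λ)) ℂ := fun _ _ Λ _ _ e U => hamiltonian (SimpleGraph.fromRel fun x y : Λ => y = e.symm ((e x).1 + 1, (e x).2) ∨ y = e.symm ((e x).1, (e x).2 + 1)) 1 U; let Tw : ∀ (L M : ℕ) [NeZero L] [NeZero M] (Λ : Type) [LinearOrder Λ] [Fintype Λ], (Λ ≃ ZMod L × ZMod M) → ℝ → Matrix (Finset (Orb Λ)) (Finset (Orb Λ)) ℂ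 := fun _ M _ _ _ _ _ e θ => ∑ b : ZMod M, ∑ σ : Fin 2, ((1 - Complex.exp (Complex.I * θ)) • (creation (orb (e.symm (0, b)) σ) * annihilation (orb (e.symm (-1, b)) σ)) + (1 - Complex.exp (-(Complex.I * θ))) • (creation (orb (e.symm (-1, b)) σ) * annihilation (orb (e.symm (0, b)) σ))); let E : ∀ (L M : ℕ) [NeZero L] [NeZero M] (Λ : Type) [LinearOrder Λ] [Fintype Λ], (Λ ≃ ZMod L × ZMod M) → ℝ → ℝ → ℕ → ℝ := fun L M _ _ Λ _ _ e U θ N => (H0 L M Λ e U + Tw L M Λ e θ).minEnergyOn (szSector N 0); let Np : ℕ → ℕ → ℝ → ℕ := fun L M δ => 2 * ⌊(1 - δ) * ((L : ℝ) * (M : ℝ)) / 2⌋₊; let stiff : ∀ (L M : ℕ) [NeZero L] [NeZero M] (Λ : Type) [LinearOrder Λ] [Fintype Λ], (Λ ≃ ZMod L × ZMod M) → ℝ → ℝ → ℝ := fun L M _ _ Λ _ _ e U δ => 2 * (L : ℝ) * (E L M Λ e U (Real.pi / 3) (Np L M δ) - E L M Λ e U 0 (Np L M δ)) / ((Real.pi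 / 3) ^ 2 * (M : ℝ)); let icomp : ∀ (L M : ℕ) [NeZero L] [NeZero M] (Λ : Type) [LinearOrder Λ] [Fintype Λ], (Λ ≃ ZMod L × ZMod M) → ℝ → ℝ → ℝ := fun L M _ _ Λ _ _ e U δ => (L : ℝ) * (M : ℝ) * (E L M Λ e U 0 (Np L M δ + 2) + E L M Λ e U 0 (Np L M δ - 2) - 2 * E L M Λ e U 0 (Np L M δ)) / 4; ∀ U : ℝ, 0 < U → ∀ δ ∈ Set.Ioo (0 : ℝ) (3 / 10), ∃ M₂ L₂ : ℕ, ∀ (L M' M'' M : ℕ) [NeZero L] [NeZero M'] [NeZero M''] [NeZero M], Even L → Even M' → Even M'' → M₂ ≤ M' → M₂ ≤ M'' → M' + M'' = M → M ≤ L → L₂ ≤ L → ∀ (Λ' : Type) [LinearOrder Λ'] [Fintype Λ'] (e' : Λ' ≃ ZMod L × ZMod M') (Λ'' : Type) [LinearOrder Λ''] [Fintype Λ''] (e'' : Λ'' ≃ ZMod L × ZMod M'') (Λ : Type) [LinearOrder Λ] [Fintype Λ] (e : Λ ≃ ZMod L × ZMod M), 0 ≤ stiff L M Λ e U δ ∧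 0 ≤ icomp L M Λ e U δ ∧ (icomp L M' Λ' e' U δ ≤ 0 → icomp L M'' Λ'' e'' U δ ≤ 0 → icomp L M Λ e U δ = 0) ∧ (0 < min (stiff L M' Λ' e' U δ) (stiff L M'' Λ'' e'' U δ) → min (stiff L M' Λ' e' U δ) (stiff L M'' Λ'' e'' U δ) / 2 ≤ stiff L M Λ e U δ) ∧ (0 < min (icomp L M' Λ' e' U δ) (icomp L M'' Λ'' e'' U δ) → min (icomp L M' Λ' e' U δ) (icomp L M'' Λ'' e'' U δ) / 2 ≤ icomp L M Λ e U δ) ∧ icomp L M Λ e U δ ≤ 2 * max (max (icomp L M' Λ' e' U δ) (icomp L M'' Λ'' e'' U δ)) 0 := by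
  dsimp only
  intro U hU δ hδ
  obtain ⟨M₂, L₂, hC⟩ := h U hU δ hδ
  refine ⟨M₂, L₂, ?_⟩
  intro L M' M'' M _ _ _ _ hL hM' hM'' h2' h2'' hsum hML hL₂ Λ' _ _ e' Λ'' _ _ e'' Λ _ _ e
  obtain ⟨h1, h2, h3⟩ := hC L M' M'' M hL hM' hM'' h2' h2'' hsum hML hL₂ Λ' e' Λ'' e'' Λ e
  have hM0 : (0 : ℝ) < M := by exact_mod_cast Nat.pos_of_ne_zero (NeZero.ne M)
  have h2M : (2 : ℝ) * M₂ ≤ M := by exact_mod_cast (show 2 * M₂ ≤ M by omega)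
  have ha : (M₂ : ℝ) / M ≤ 1 / 2 := by
    rw [div_le_iff₀ hM0]; linarith
  exact locality_arith (by positivity) ha h1 h2 h3

/-! ## §2 The kill menu: `¬ C` modulo a cofinal family at one point of the window

Each hypothesis below says: at SOME `(U, δ) ∈ (0,∞) × (0,3/10)`, for EVERY threshold pair
`(M₂, L₂)` there is an admissible equal-width gluing `m + m` beyond the thresholds exhibiting the
named behaviour. Each is believed PHYSICALLY PLAUSIBLE somewhere in the window (metallic or striped
points: `(U,δ) → (0⁺, ·)` Fermi-surface shell effects — refuter U = 0 scan: `stiff < 0` on > 50 %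
of free tubes at every `L ≤ 96`; `(8, 1/8)` filled stripes, QinEtAl2020) and NONE is provable with
present technique (ground states of arbitrarily large doped Hubbard tubes). -/

/-- **Kill 1 (paramagnetic glued tubes).** If at one point of the window the glued even tubes of
width `2m` have `E(π/3) < E(0)` cofinally in `(L, m)`, the crux is false (by hidden claim (i)).
[folklore] -/
theorem seamGluingLocality_false_of_cofinalParamagnet
    (hP : open Matrix Literature.MathematicalPhysics.QuantumLattice in let H0 : ∀ (L M : ℕ) (Λ : Type) [LinearOrder Λ] [Fintype Λ], (Λ ≃ ZMod L × ZMod M) → ℝ → Matrix (Finset (Orb Λ)) (Finset (Orb Λ)) ℂ := fun _ _ Λ _ _ e U => hamiltonian (SimpleGraph.fromRel fun x y : Λ => y = e.symm ((e x).1 + 1, (e x).2) ∨ y = e.symm ((e x).1, (e x).2 + 1)) 1 U; let Tw : ∀ (L M : ℕ) [NeZero L] [NeZero M] (Λ : Type) [LinearOrder Λ] [Fintype Λ], (Λ ≃ ZMod L × ZMod M) → ℝ → Matrix (Finset (Orb Λ)) (Finset (Orb Λ)) ℂ := fun _ M _ _ _ _ _ e θ => ∑ b : ZMod M, ∑ σ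 : Fin 2, ((1 - Complex.exp (Complex.I * θ)) • (creation (orb (e.symm (0, b)) σ) * annihilation (orb (e.symm (-1, b)) σ)) + (1 - Complex.exp (-(Complex.I * θ))) • (creation (orb (e.symm (-1, b)) σ) * annihilation (orb (e.symm (0, b)) σ))); let E : ∀ (L M : ℕ) [NeZero L] [NeZero M] (Λ : Type) [LinearOrder Λ] [Fintype Λ], (Λ ≃ ZMod L × ZMod M) → ℝ → ℝ → ℕ → ℝ := fun L M _ _ Λ _ _ e U θ N => (H0 L M Λ e U + Tw L M Λ e θ).minEnergyOn (szSector N 0); let Np : ℕ → ℕ → ℝ → ℕ := fun L M δ => 2 * ⌊(1 - δ) * ((L : ℝ) * (M : ℝ)) / 2⌋₊; let stiff : ∀ (L M : ℕ) [NeZero L] [NeZero M] (Λ : Type) [LinearOrder Λ] [Fintype Λ], (Λ ≃ ZMod L × ZMod M) → ℝ → ℝ → ℝ := fun L M _ _ Λ _ _ e U δ => 2 * (L : ℝ) * (E L M Λ e U (Real.pi / 3) (Np L M δ) - E L M Λ e U 0 (Np L M δ)) / ((Real.pi / 3) ^ 2 * (M : ℝ)); ∃ U : ℝ, 0 < U ∧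 ∃ δ ∈ Set.Ioo (0 : ℝ) (3 / 10), ∀ M₂ L₂ : ℕ, ∃ (L m : ℕ) (_ : NeZero L) (_ : NeZero m) (_ : NeZero (m + m)), Even L ∧ Even m ∧ M₂ ≤ m ∧ m + m ≤ L ∧ L₂ ≤ L ∧ ∃ (Λ : Type) (_ : LinearOrder Λ) (_ : Fintype Λ) (e : Λ ≃ ZMod L × ZMod (m + m)), stiff L (m + m) Λ e U δ < 0) :
    ¬ SeamGluingLocality := by
  intro h
  have hh := seamGluingLocality_hidden h
  dsimp only at hP hh
  obtain ⟨U, hU, δ, hδ, hP⟩ := hP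
  obtain ⟨M₂, L₂, hC⟩ := hh U hU δ hδ
  obtain ⟨L, m, iL, im, iM, hL, hm, hM₂, hmL, hL₂, Λ, _, _, e, hlt⟩ := hP M₂ L₂
  obtain ⟨e', -⟩ : ∃ _e : Fin (L * m) ≃ ZMod L × ZMod m, True := ⟨finProdFinEquiv.symm.trans (Equiv.prodCongr (ZMod.finEquiv L).toEquiv (ZMod.finEquiv m).toEquiv), trivial⟩
  obtain ⟨h0, -⟩ := hC L m m (m + m) hL hm hm hM₂ hM₂ rfl hmL hL₂ (Fin (L * m)) e' (Fin (L * m)) e' Λ e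
  exact absurd h0 (not_le.mpr hlt)

/-- **Kill 2 (concave even-`N` staircase).** If at one point of the window the glued even tubes of
width `2m` have `E(N+2) + E(N−2) − 2E(N) < 0` cofinally, the crux is false (hidden claim (ii)).
[folklore] -/
theorem seamGluingLocality_false_of_cofinalConcave
    (hP : open Matrix Literature.MathematicalPhysics.QuantumLattice in let H0 : ∀ (L M : ℕ) (Λ : Type) [LinearOrder Λ] [Fintype Λ], (Λ ≃ ZMod L × ZMod M) → ℝ → Matrix (Finset (Orb Λ)) (Finset (Orb Λ)) ℂ := fun _ _ Λ _ _ e U => hamiltonian (SimpleGraph.fromRel fun x y : Λ => y = e.symm ((e x).1 + 1, (e x).2) ∨ y = e.symm ((e x).1, (e x).2 + 1)) 1 U; let Tw : ∀ (L M : ℕ) [NeZero L] [NeZero M] (Λ : Type) [LinearOrder Λ] [Fintype Λ], (Λ ≃ ZMod L × ZMod M) → ℝ → Matrix (Finset (Orb Λ)) (Finset (Orb Λ)) ℂ := fun _ M _ _ _ _ _ e θ => ∑ b : ZMod M, ∑ σ : Fin 2, ((1 - Complex.exp (Complex.I * θ)) • (creation (orb (e.symm (0, b)) σ) * annihilation (orb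 (e.symm (-1, b)) σ)) + (1 - Complex.exp (-(Complex.I * θ))) • (creation (orb (e.symm (-1, b)) σ) * annihilation (orb (e.symm (0, b)) σ))); let E : ∀ (L M : ℕ) [NeZero L] [NeZero M] (Λ : Type) [LinearOrder Λ] [Fintype Λ], (Λ ≃ ZMod L × ZMod M) → ℝ → ℝ → ℕ → ℝ := fun L M _ _ Λ _ _ e U θ N => (H0 L M Λ e U + Tw L M Λ e θ).minEnergyOn (szSector N 0); let Np : ℕ → ℕ → ℝ → ℕ := fun L M δ => 2 * ⌊(1 - δ) * ((L : ℝ) * (M : ℝ)) / 2⌋₊; let icomp : ∀ (L M : ℕ) [NeZero L] [NeZero M] (Λ : Type) [LinearOrder Λ] [Fintype Λ], (Λ ≃ ZMod L × ZMod M) → ℝ → ℝ → ℝ := fun L M _ _ Λ _ _ e U δ => (L : ℝ) * (M : ℝ) * (E L M Λ e U 0 (Np L M δ + 2) + E L M Λ e U 0 (Np L M δ - 2) - 2 * E L M Λ e U 0 (Np L M δ)) / 4; ∃ U : ℝ, 0 < U ∧ ∃ δ ∈ Set.Ioo (0 : ℝ) (3 / 10), ∀ M₂ L₂ : ℕ,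 ∃ (L m : ℕ) (_ : NeZero L) (_ : NeZero m) (_ : NeZero (m + m)), Even L ∧ Even m ∧ M₂ ≤ m ∧ m + m ≤ L ∧ L₂ ≤ L ∧ ∃ (Λ : Type) (_ : LinearOrder Λ) (_ : Fintype Λ) (e : Λ ≃ ZMod L × ZMod (m + m)), icomp L (m + m) Λ e U δ < 0) :
    ¬ SeamGluingLocality := by
  intro h
  have hh := seamGluingLocality_hidden h
  dsimp only at hP hh
  obtain ⟨U, hU, δ, hδ, hP⟩ := hP
  obtain ⟨M₂, L₂, hC⟩ := hh U hU δ hδ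
  obtain ⟨L, m, iL, im, iM, hL, hm, hM₂, hmL, hL₂, Λ, _, _, e, hlt⟩ := hP M₂ L₂
  obtain ⟨e', -⟩ : ∃ _e : Fin (L * m) ≃ ZMod L × ZMod m, True := ⟨finProdFinEquiv.symm.trans (Equiv.prodCongr (ZMod.finEquiv L).toEquiv (ZMod.finEquiv m).toEquiv), trivial⟩
  obtain ⟨-, h0, -⟩ := hC L m m (m + m) hL hm hm hM₂ hM₂ rfl hmL hL₂ (Fin (L * m)) e' (Fin (L * m)) e' Λ e
  exact absurd h0 (not_le.mpr hlt)

/-- **Kill 3 (failure of exact degeneracy).** If at one point of the window, cofinally, some part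
of width `m` is unstable (`icomp_m ≤ 0`, e.g. phase separation / a concave step of the even-`N`
staircase) while the glued tube of width `2m` has `icomp_{2m} ≠ 0`, the crux is false: C forces
the glued second difference to VANISH EXACTLY (hidden claim (iii)) — a non-generic coincidence of
three sector minima. [folklore] -/
theorem seamGluingLocality_false_of_exactDegeneracyFailure
    (hP : open Matrix Literature.MathematicalPhysics.QuantumLattice in let H0 : ∀ (L M : ℕ) (Λ : Type) [LinearOrder Λ] [Fintype Λ], (Λ ≃ ZMod L × ZMod M) → ℝ → Matrix (Finset (Orb Λ)) (Finset (Orb Λ)) ℂ := fun _ _ Λ _ _ e U => hamiltonian (SimpleGraph.fromRel fun x y : Λ => y = e.symm ((e x).1 + 1, (e x).2) ∨ y = e.symm ((e x).1, (e x).2 + 1)) 1 U; let Tw : ∀ (L M : ℕ) [NeZero L] [NeZero M] (Λ : Type) [LinearOrder Λ] [Fintype Λ], (Λ ≃ ZMod L × ZMod M) → ℝ → Matrix (Finset (Orb Λ)) (Finset (Orb Λ)) ℂ := fun _ M _ _ _ _ _ e θ => ∑ b : ZMod M, ∑ σ : Fin 2, ((1 - Complex.exp (Complex.I * θ)) • (creation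 (orb (e.symm (0, b)) σ) * annihilation (orb (e.symm (-1, b)) σ)) + (1 - Complex.exp (-(Complex.I * θ))) • (creation (orb (e.symm (-1, b)) σ) * annihilation (orb (e.symm (0, b)) σ))); let E : ∀ (L M : ℕ) [NeZero L] [NeZero M] (Λ : Type) [LinearOrder Λ] [Fintype Λ], (Λ ≃ ZMod L × ZMod M) → ℝ → ℝ → ℕ → ℝ := fun L M _ _ Λ _ _ e U θ N => (H0 L M Λ e U + Tw L M Λ e θ).minEnergyOn (szSector N 0); let Np : ℕ → ℕ → ℝ → ℕ := fun L M δ => 2 * ⌊(1 - δ) * ((L : ℝ) * (M : ℝ)) / 2⌋₊; let icomp : ∀ (L M : ℕ) [NeZero L] [NeZero M] (Λ : Type) [LinearOrder Λ] [Fintype Λ], (Λ ≃ ZMod L × ZMod M) → ℝ → ℝ → ℝ := fun L M _ _ Λ _ _ e U δ => (L : ℝ) * (M : ℝ) * (E L M Λ e U 0 (Np L M δ + 2) + E L M Λ e U 0 (Np L M δ - 2) - 2 * E L M Λ e U 0 (Np L M δ)) / 4; ∃ U : ℝ, 0 < U ∧ ∃ δ ∈ Set.Ioo (0 : ℝ)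 (3 / 10), ∀ M₂ L₂ : ℕ, ∃ (L m : ℕ) (_ : NeZero L) (_ : NeZero m) (_ : NeZero (m + m)), Even L ∧ Even m ∧ M₂ ≤ m ∧ m + m ≤ L ∧ L₂ ≤ L ∧ ∃ (Λ' : Type) (_ : LinearOrder Λ') (_ : Fintype Λ') (e' : Λ' ≃ ZMod L × ZMod m) (Λ : Type) (_ : LinearOrder Λ) (_ : Fintype Λ) (e : Λ ≃ ZMod L × ZMod (m + m)), icomp L m Λ' e' U δ ≤ 0 ∧ icomp L (m + m) Λ e U δ ≠ 0) :
    ¬ SeamGluingLocality := by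
  intro h
  have hh := seamGluingLocality_hidden h
  dsimp only at hP hh
  obtain ⟨U, hU, δ, hδ, hP⟩ := hP
  obtain ⟨M₂, L₂, hC⟩ := hh U hU δ hδ
  obtain ⟨L, m, iL, im, iM, hL, hm, hM₂, hmL, hL₂, Λ', _, _, e', Λ, _, _, e, hle, hne⟩ := hP M₂ L₂
  obtain ⟨-, -, h0, -⟩ := hC L m m (m + m) hL hm hm hM₂ hM₂ rfl hmL hL₂ Λ' e' Λ' e' Λ e
  exact hne (h0 hle hle)

/-- **Kill 4 (soft doubling — the planner's own kill scenario, typed).** If at one point of the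
window, cofinally, a part of width `m` is stiff (`stiff_m > 0`) but the glued tube of width `2m`
has less than HALF its stiffness (`stiff_{2m} < stiff_m / 2`: e.g. C1S0 ladders gluing to a CEX /
striped / paramagnetic tube, LinBalentsFisher1997 §V), the crux is false (hidden claim (iv) with
`M′ = M″`). The factor `1/2` is absolute: `C` tolerates NO `O(1)` loss on doubling, however
small the parts' stiffness. [folklore] -/
theorem seamGluingLocality_false_of_softDoubling
    (hP : open Matrix Literature.MathematicalPhysics.QuantumLattice in let H0 : ∀ (L M : ℕ) (Λ : Type) [LinearOrder Λ] [Fintype Λ], (Λ ≃ ZMod L × ZMod M) → ℝ → Matrix (Finset (Orb Λ)) (Finset (Orb Λ)) ℂ := fun _ _ Λ _ _ e U => hamiltonian (SimpleGraph.fromRel fun x y : Λ => y = e.symm ((e x).1 + 1, (e x).2) ∨ y = e.symm ((e x).1, (e x).2 + 1)) 1 U; let Tw : ∀ (L M : ℕ) [NeZero L] [NeZero M] (Λ : Type) [LinearOrder Λ] [Fintype Λ], (Λ ≃ ZMod L × ZMod M) → ℝ → Matrix (Finset (Orb Λ)) (Finset (Orb Λ)) ℂ := fun _ M _ _ _ _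 _ e θ => ∑ b : ZMod M, ∑ σ : Fin 2, ((1 - Complex.exp (Complex.I * θ)) • (creation (orb (e.symm (0, b)) σ) * annihilation (orb (e.symm (-1, b)) σ)) + (1 - Complex.exp (-(Complex.I * θ))) • (creation (orb (e.symm (-1, b)) σ) * annihilation (orb (e.symm (0, b)) σ))); let E : ∀ (L M : ℕ) [NeZero L] [NeZero M] (Λ : Type) [LinearOrder Λ] [Fintype Λ], (Λ ≃ ZMod L × ZMod M) → ℝ → ℝ → ℕ → ℝ := fun L M _ _ Λ _ _ e U θ N => (H0 L M Λ e U + Tw L M Λ e θ).minEnergyOn (szSector N 0); let Np : ℕ → ℕ → ℝ → ℕ := fun L M δ => 2 * ⌊(1 - δ) * ((L : ℝ) * (M : ℝ)) / 2⌋₊; let stiff : ∀ (L M : ℕ) [NeZero L] [NeZero M] (Λ : Type) [LinearOrder Λ] [Fintype Λ], (Λ ≃ ZMod L × ZMod M) → ℝ → ℝ → ℝ := fun L M _ _ Λ _ _ e U δ => 2 * (L : ℝ) * (E L M Λ e U (Real.pi / 3) (Np L M δ) - E L M Λ e U 0 (Np L M δ)) / ((Real.pi / 3) ^ 2 * (M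 : ℝ)); ∃ U : ℝ, 0 < U ∧ ∃ δ ∈ Set.Ioo (0 : ℝ) (3 / 10), ∀ M₂ L₂ : ℕ, ∃ (L m : ℕ) (_ : NeZero L) (_ : NeZero m) (_ : NeZero (m + m)), Even L ∧ Even m ∧ M₂ ≤ m ∧ m + m ≤ L ∧ L₂ ≤ L ∧ ∃ (Λ' : Type) (_ : LinearOrder Λ') (_ : Fintype Λ') (e' : Λ' ≃ ZMod L × ZMod m) (Λ : Type) (_ : LinearOrder Λ) (_ : Fintype Λ) (e : Λ ≃ ZMod L × ZMod (m + m)), 0 < stiff L m Λ' e' U δ ∧ stiff L (m + m) Λ e U δ < stiff L m Λ' e' U δ / 2) :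
    ¬ SeamGluingLocality := by
  intro h
  have hh := seamGluingLocality_hidden h
  dsimp only at hP hh
  obtain ⟨U, hU, δ, hδ, hP⟩ := hP
  obtain ⟨M₂, L₂, hC⟩ := hh U hU δ hδ
  obtain ⟨L, m, iL, im, iM, hL, hm, hM₂, hmL, hL₂, Λ', _, _, e', Λ, _, _, e, hpos, hlt⟩ := hP M₂ L₂
  obtain ⟨-, -, -, h0, -⟩ := hC L m m (m + m) hL hm hm hM₂ hM₂ rfl hmL hL₂ Λ' e' Λ' e' Λ e
  have := h0 (by simpa only [min_self] using hpos)
  simp only [min_self] at this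
  linarith

/-- **Kill 5 (icomp jump on doubling).** If at one point of the window, cofinally, a compressible
part (`icomp_m > 0`) glues to a tube whose `icomp_{2m}` leaves the band `[icomp_m/2, 3·icomp_m/2]`,
the crux is false (hidden claims (v), (vi) with `M′ = M″`; `1 + M₂/M ≤ 3/2`). [folklore] -/
theorem seamGluingLocality_false_of_icompJump
    (hP : open Matrix Literature.MathematicalPhysics.QuantumLattice in let H0 : ∀ (L M : ℕ) (Λ : Type) [LinearOrder Λ] [Fintype Λ], (Λ ≃ ZMod L × ZMod M) → ℝ → Matrix (Finset (Orb Λ)) (Finset (Orb Λ)) ℂ := fun _ _ Λ _ _ e U => hamiltonian (SimpleGraph.fromRel fun x y : Λ => y = e.symm ((e x).1 + 1, (e x).2) ∨ y = e.symm ((e x).1, (e x).2 + 1)) 1 U; let Tw : ∀ (L M : ℕ) [NeZero L] [NeZero M] (Λ : Type) [LinearOrder Λ] [Fintype Λ], (Λ ≃ ZMod L × ZMod M) → ℝ → Matrix (Finset (Orb Λ)) (Finset (Orb Λ)) ℂ := fun _ M _ _ _ _ _ e θ => ∑ b : ZMod M, ∑ σ : Fin 2, ((1 - Complex.exp (Complex.I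 * θ)) • (creation (orb (e.symm (0, b)) σ) * annihilation (orb (e.symm (-1, b)) σ)) + (1 - Complex.exp (-(Complex.I * θ))) • (creation (orb (e.symm (-1, b)) σ) * annihilation (orb (e.symm (0, b)) σ))); let E : ∀ (L M : ℕ) [NeZero L] [NeZero M] (Λ : Type) [LinearOrder Λ] [Fintype Λ], (Λ ≃ ZMod L × ZMod M) → ℝ → ℝ → ℕ → ℝ := fun L M _ _ Λ _ _ e U θ N => (H0 L M Λ e U + Tw L M Λ e θ).minEnergyOn (szSector N 0); let Np : ℕ → ℕ → ℝ → ℕ := fun L M δ => 2 * ⌊(1 - δ) * ((L : ℝ) * (M : ℝ)) / 2⌋₊; let icomp : ∀ (L M : ℕ) [NeZero L] [NeZero M] (Λ : Type) [LinearOrder Λ] [Fintype Λ], (Λ ≃ ZMod L × ZMod M) → ℝ → ℝ → ℝ := fun L M _ _ Λ _ _ e U δ => (L : ℝ) * (M : ℝ) * (E L M Λ e U 0 (Np L M δ + 2) + E L M Λ e U 0 (Np L M δ - 2) - 2 * E L M Λ e U 0 (Np L M δ)) / 4; ∃ U : ℝ, 0 < U ∧ ∃ δ ∈ Set.Ioo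 (0 : ℝ) (3 / 10), ∀ M₂ L₂ : ℕ, ∃ (L m : ℕ) (_ : NeZero L) (_ : NeZero m) (_ : NeZero (m + m)), Even L ∧ Even m ∧ M₂ ≤ m ∧ m + m ≤ L ∧ L₂ ≤ L ∧ ∃ (Λ' : Type) (_ : LinearOrder Λ') (_ : Fintype Λ') (e' : Λ' ≃ ZMod L × ZMod m) (Λ : Type) (_ : LinearOrder Λ) (_ : Fintype Λ) (e : Λ ≃ ZMod L × ZMod (m + m)), 0 < icomp L m Λ' e' U δ ∧ (icomp L (m + m) Λ e U δ < icomp L m Λ' e' U δ / 2 ∨ 3 / 2 * icomp L m Λ' e' U δ < icomp L (m + m) Λ e U δ)) :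
    ¬ SeamGluingLocality := by
  intro h
  dsimp only at hP
  obtain ⟨U, hU, δ, hδ, hP⟩ := hP
  obtain ⟨M₂, L₂, hC⟩ := h U hU δ hδ
  obtain ⟨L, m, iL, im, iM, hL, hm, hM₂, hmL, hL₂, Λ', _, _, e', Λ, _, _, e, hpos, hjump⟩ := hP M₂ L₂
  obtain ⟨-, h2, h3⟩ := hC L m m (m + m) hL hm hm hM₂ hM₂ rfl hmL hL₂ Λ' e' Λ' e' Λ e
  simp only [min_self, max_self] at h2 h3
  have hm0 : (0 : ℝ) < m := by exact_mod_cast Nat.pos_of_ne_zero (NeZero.ne m)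
  have hM₂m : (M₂ : ℝ) ≤ m := by exact_mod_cast hM₂
  have ha : (M₂ : ℝ) / ((m + m : ℕ) : ℝ) ≤ 1 / 2 := by
    have hmm : ((m + m : ℕ) : ℝ) = m + m := by push_cast; ring
    rw [hmm, div_le_iff₀ (by positivity)]; linarith
  exact jump_arith ha hpos h2 h3 hjump

/-- HYPOTHESIS of Kill 6 restated from the strategist's `NegativeGapExtensivity.lean` (crux
workfile, not importable from here): **width-uniform pair charge gap at some point of the window**
— there are `U > 0`, `δ ∈ (0,3/10)`, `0 < g`, `G < 4g/3`, `m₀` such that every even width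
`m ≥ m₀` has, for all long even `L` and every labelling, `g·L·m ≤ icomp_{L,m} ≤ G·L·m`
(two-particle charge gap `Δ²_N E ∈ [4g, 4G]`, nearly width-independent; heuristically the
filled-stripe insulator at `(8, 1/8)`, QinEtAl2020 — an OPEN statement, proved nowhere).
**Kill 6.** It contradicts the crux: `icomp` is then EXTENSIVE, so doubling the width doubles it,
against the ceiling factor `3/2` (Kill 5). Credit: planner-cstrat-…-18509-b1
(`not_seamGluingLocality_of_uniformPairGap`); re-derived here as a corollary of Kill 5. [folklore] -/
theorem seamGluingLocality_false_of_uniformPairGap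
    (hgap : open Matrix Literature.MathematicalPhysics.QuantumLattice in let H0 : ∀ (L M : ℕ) (Λ : Type) [LinearOrder Λ] [Fintype Λ], (Λ ≃ ZMod L × ZMod M) → ℝ → Matrix (Finset (Orb Λ)) (Finset (Orb Λ)) ℂ := fun _ _ Λ _ _ e U => hamiltonian (SimpleGraph.fromRel fun x y : Λ => y = e.symm ((e x).1 + 1, (e x).2) ∨ y = e.symm ((e x).1, (e x).2 + 1)) 1 U; let Tw : ∀ (L M : ℕ) [NeZero L] [NeZero M] (Λ : Type) [LinearOrder Λ] [Fintype Λ], (Λ ≃ ZMod L × ZMod M) → ℝ → Matrix (Finset (Orb Λ)) (Finset (Orb Λ)) ℂ := fun _ M _ _ _ _ _ e θ => ∑ b : ZMod M, ∑ σ : Fin 2, ((1 - Complex.exp (Complex.I * θ)) • (creation (orb (e.symm (0, b)) σ) * annihilation (orb (e.symm (-1, b)) σ)) + (1 - Complex.exp (-(Complex.I * θ))) • (creation (orb (e.symm (-1, b)) σ) * annihilation (orb (e.symm (0, b)) σ))); let E : ∀ (L M : ℕ) [NeZero L] [NeZero M] (Λ : Type) [LinearOrder Λ] [Fintype Λ],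 (Λ ≃ ZMod L × ZMod M) → ℝ → ℝ → ℕ → ℝ := fun L M _ _ Λ _ _ e U θ N => (H0 L M Λ e U + Tw L M Λ e θ).minEnergyOn (szSector N 0); let Np : ℕ → ℕ → ℝ → ℕ := fun L M δ => 2 * ⌊(1 - δ) * ((L : ℝ) * (M : ℝ)) / 2⌋₊; let icomp : ∀ (L M : ℕ) [NeZero L] [NeZero M] (Λ : Type) [LinearOrder Λ] [Fintype Λ], (Λ ≃ ZMod L × ZMod M) → ℝ → ℝ → ℝ := fun L M _ _ Λ _ _ e U δ => (L : ℝ) * (M : ℝ) * (E L M Λ e U 0 (Np L M δ + 2) + E L M Λ e U 0 (Np L M δ - 2) - 2 * E L M Λ e U 0 (Np L M δ)) / 4; ∃ U : ℝ, 0 < U ∧ ∃ δ ∈ Set.Ioo (0 : ℝ) (3 / 10), ∃ g G : ℝ, 0 < g ∧ G < 4 / 3 * g ∧ ∃ m₀ : ℕ, ∀ (m : ℕ) [NeZero m], Even m → m₀ ≤ m → ∃ L₁ : ℕ, ∀ (L : ℕ) [NeZero L], Even L → m ≤ L → L₁ ≤ L → ∀ (Λ : Type) [LinearOrder Λ] [Fintype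 Λ] (e : Λ ≃ ZMod L × ZMod m), g * L * m ≤ icomp L m Λ e U δ ∧ icomp L m Λ e U δ ≤ G * L * m) :
    ¬ SeamGluingLocality := by
  refine seamGluingLocality_false_of_icompJump ?_
  dsimp only at hgap ⊢
  obtain ⟨U, hU, δ, hδ, g, G, hg, hG, m₀, hgap⟩ := hgap
  refine ⟨U, hU, δ, hδ, ?_⟩
  intro M₂ L₂
  obtain ⟨m, hmE, hmM₂, hmm₀, hm0⟩ : ∃ m : ℕ, Even m ∧ M₂ ≤ m ∧ m₀ ≤ m ∧ 0 < m :=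
    ⟨2 * (M₂ + m₀ + 1), even_two_mul _, by omega, by omega, by omega⟩
  haveI im : NeZero m := ⟨by omega⟩
  haveI iM : NeZero (m + m) := ⟨by omega⟩
  have hME : Even (m + m) := ⟨m, rfl⟩
  obtain ⟨L₁, hm₁⟩ := @hgap m im hmE hmm₀
  obtain ⟨L₁', hM₁⟩ := @hgap (m + m) iM hME (by omega)
  obtain ⟨L, hLE, hL1, hL2, hL3, hL4⟩ :
      ∃ L : ℕ, Even L ∧ L₁ ≤ L ∧ L₁' ≤ L ∧ L₂ ≤ L ∧ m + m ≤ L :=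
    ⟨2 * (L₁ + L₁' + L₂ + m + 1), even_two_mul _, by omega, by omega, by omega, by omega⟩
  haveI iL : NeZero L := ⟨by omega⟩
  obtain ⟨e', -⟩ : ∃ _e : Fin (L * m) ≃ ZMod L × ZMod m, True := ⟨finProdFinEquiv.symm.trans (Equiv.prodCongr (ZMod.finEquiv L).toEquiv (ZMod.finEquiv m).toEquiv), trivial⟩
  obtain ⟨e, -⟩ : ∃ _e : Fin (L * (m + m)) ≃ ZMod L × ZMod (m + m), True :=
    ⟨finProdFinEquiv.symm.trans (Equiv.prodCongr (ZMod.finEquiv L).toEquiv (ZMod.finEquiv (m + m)).toEquiv), trivial⟩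
  obtain ⟨hlo', hhi'⟩ := @hm₁ L iL hLE (by omega) hL1 (Fin (L * m)) _ _ e'
  obtain ⟨hlo, -⟩ := @hM₁ L iL hLE hL4 hL2 (Fin (L * (m + m))) _ _ e
  refine ⟨L, m, iL, im, iM, hLE, hmE, hmM₂, hL4, hL3, Fin (L * m), inferInstance, inferInstance, e',
    Fin (L * (m + m)), inferInstance, inferInstance, e, ?_, Or.inr ?_⟩
  · have hL0 : (0 : ℝ) < L := by exact_mod_cast Nat.pos_of_ne_zero (NeZero.ne L)
    have hm0R : (0 : ℝ) < m := by exact_mod_cast hm0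
    have : 0 < g * L * m := by positivity
    linarith
  · have hL0 : (0 : ℝ) < L := by exact_mod_cast Nat.pos_of_ne_zero (NeZero.ne L)
    have hm0R : (0 : ℝ) < m := by exact_mod_cast hm0
    have h2g : g * (L : ℝ) * ((m + m : ℕ) : ℝ) = 2 * (g * L * m) := by push_cast; ring
    rw [h2g] at hlo
    have hLm : 0 < (L : ℝ) * m := by positivity
    nlinarith [mul_lt_mul_of_pos_right hG hLm, mul_pos hg hLm]

/-! ## §3 Load-bearing hypotheses: one hypothesis dropped = a strengthening of `C`

`C` has the hypotheses `0 < U`, `δ ∈ (0,3/10)`, parities, the width/length thresholds `M₂, L₂`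
(existential, i.e. in favour of `C`) and `M ≤ L`. Dropping one gives a STRONGER statement; its
negation is a NEGATIVE LEMMA "any proof of `C` must use that hypothesis". Two are typed here. -/

/-- `C` with `U = 0` admitted (`0 ≤ U` in place of `0 < U`): the free-fermion member is included.
[difficulty: M] -/
def SeamGluingLocalityFromZeroU : Prop :=
  open Matrix Literature.MathematicalPhysics.QuantumLattice in let H0 : ∀ (L M : ℕ) (Λ : Type) [LinearOrder Λ] [Fintype Λ], (Λ ≃ ZMod L × ZMod M) → ℝ → Matrix (Finset (Orb Λ)) (Finset (Orb Λ)) ℂ := fun _ _ Λ _ _ e U => hamiltonian (SimpleGraph.fromRel fun x y : Λ => y = e.symm ((e x).1 + 1, (e x).2) ∨ y = e.symm ((e x).1, (e x).2 + 1)) 1 U; let Tw : ∀ (L M : ℕ) [NeZero L] [NeZero M] (Λ : Type) [LinearOrder Λ] [Fintype Λ], (Λ ≃ ZMod L × ZMod M) → ℝ → Matrix (Finset (Orb Λ)) (Finset (Orb Λ)) ℂ := fun _ M _ _ _ _ _ e θ => ∑ b : ZMod M, ∑ σ : Fin 2, ((1 - Complex.exp (Complex.I * θ)) • (creation (orb (e.symm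 (0, b)) σ) * annihilation (orb (e.symm (-1, b)) σ)) + (1 - Complex.exp (-(Complex.I * θ))) • (creation (orb (e.symm (-1, b)) σ) * annihilation (orb (e.symm (0, b)) σ))); let E : ∀ (L M : ℕ) [NeZero L] [NeZero M] (Λ : Type) [LinearOrder Λ] [Fintype Λ], (Λ ≃ ZMod L × ZMod M) → ℝ → ℝ → ℕ → ℝ := fun L M _ _ Λ _ _ e U θ N => (H0 L M Λ e U + Tw L M Λ e θ).minEnergyOn (szSector N 0); let Np : ℕ → ℕ → ℝ → ℕ := fun L M δ => 2 * ⌊(1 - δ) * ((L : ℝ) * (M : ℝ)) / 2⌋₊; let stiff : ∀ (L M : ℕ) [NeZero L] [NeZero M] (Λ : Type) [LinearOrder Λ] [Fintype Λ], (Λ ≃ ZMod L × ZMod M) → ℝ → ℝ → ℝ := fun L M _ _ Λ _ _ e U δ => 2 * (L : ℝ) * (E L M Λ e U (Real.pi / 3) (Np L M δ) - E L M Λ e U 0 (Np L M δ)) / ((Real.pi / 3) ^ 2 * (M : ℝ)); let icomp : ∀ (L M : ℕ) [NeZero L] [NeZero M] (Λ : Type) [LinearOrder Λ] [Fintype Λ],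 (Λ ≃ ZMod L × ZMod M) → ℝ → ℝ → ℝ := fun L M _ _ Λ _ _ e U δ => (L : ℝ) * (M : ℝ) * (E L M Λ e U 0 (Np L M δ + 2) + E L M Λ e U 0 (Np L M δ - 2) - 2 * E L M Λ e U 0 (Np L M δ)) / 4; ∀ U : ℝ, 0 ≤ U → ∀ δ ∈ Set.Ioo (0 : ℝ) (3 / 10), ∃ M₂ L₂ : ℕ, ∀ (L M' M'' M : ℕ) [NeZero L] [NeZero M'] [NeZero M''] [NeZero M], Even L → Even M' → Even M'' → M₂ ≤ M' → M₂ ≤ M'' → M' + M'' = M → M ≤ L → L₂ ≤ L → ∀ (Λ' : Type) [LinearOrder Λ'] [Fintype Λ'] (e' : Λ' ≃ ZMod L × ZMod M') (Λ'' : Type) [LinearOrder Λ''] [Fintype Λ''] (e'' : Λ'' ≃ ZMod L × ZMod M'') (Λ : Type) [LinearOrder Λ] [Fintype Λ] (e : Λ ≃ ZMod L × ZMod M), (1 - (M₂ : ℝ) / M) * max (min (stiff L M' Λ' e' U δ) (stiff L M'' Λ'' e'' U δ)) 0 ≤ stiff L M Λ e U δ ∧ (1 - (M₂ : ℝ) /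 M) * max (min (icomp L M' Λ' e' U δ) (icomp L M'' Λ'' e'' U δ)) 0 ≤ icomp L M Λ e U δ ∧ icomp L M Λ e U δ ≤ (1 + (M₂ : ℝ) / M) * max (max (icomp L M' Λ' e' U δ) (icomp L M'' Λ'' e'' U δ)) 0

/-- It is a strengthening: `SeamGluingLocalityFromZeroU → C`. [folklore] -/
theorem seamGluingLocality_of_fromZeroU (h : SeamGluingLocalityFromZeroU) : SeamGluingLocality := by
  dsimp only [SeamGluingLocalityFromZeroU] at h
  dsimp only [SeamGluingLocality]
  intro U hU
  exact h U hU.le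

/-- NEAR-MISS (believed true, not closable here). **Any proof of `C` must use `U > 0`
non-perturbatively**: at `U = 0` (free fermions) the sector minima are Fermi-sea sums and the three
inequalities fail by Fermi-surface shell/parity effects that do NOT decay in `L` — refuter
`crux-attack-18509.md` (exact scan, all even `L ≤ 96`, `δ ∈ {0.05, 1/8, 1/4, 0.29}`,
`M₂ ≤ 16`): (1) violated in 54–57 % of admissible gluings (12–15 % with both parts stiff),
(2) in 6–8 %, (3) in 13–18 %, `stiff < 0` on > 50 % of tubes (`|stiff| ≈ 0.2` wide). A Lean proof
needs (a) the free-fermion reduction `minEnergyOn (szSector N 0) = 2·Σ (lowest N/2 levels)` on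
the torus with seam flux and (b) closed-form Fermi-sea sums exhibiting a violation for an
INFINITE family `(L_j, m_j) → ∞` at one `δ` — not attempted (weeks of infrastructure; the content
is uncontroversial physics-wise but is evidence-only here). Obstruction recorded; what was tried:
nothing in Lean beyond typing. -/
theorem not_seamGluingLocalityFromZeroU : ¬ SeamGluingLocalityFromZeroU := by
  sorry

/-- `C` with NO thresholds (`M₂ = L₂ = 0`, factor `1`): locality claimed for all even sizes.
[difficulty: S (numerically), uncertifiable in Lean] -/
def SeamGluingLocalityAllSizes : Prop :=
  open Matrix Literature.MathematicalPhysics.QuantumLattice in let H0 : ∀ (L M : ℕ) (Λ : Type) [LinearOrder Λ] [Fintype Λ], (Λ ≃ ZMod L × ZMod M) → ℝ → Matrix (Finset (Orb Λ)) (Finset (Orb Λ)) ℂ := fun _ _ Λ _ _ e U => hamiltonian (SimpleGraph.fromRel fun x y : Λ => y = e.symm ((e x).1 + 1, (e x).2) ∨ y = e.symm ((e x).1, (e x).2 + 1)) 1 U; let Tw : ∀ (L M : ℕ) [NeZero L] [NeZero M] (Λ : Type) [LinearOrder Λ] [Fintype Λ], (Λ ≃ ZMod L × ZMod M) → ℝ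 → Matrix (Finset (Orb Λ)) (Finset (Orb Λ)) ℂ := fun _ M _ _ _ _ _ e θ => ∑ b : ZMod M, ∑ σ : Fin 2, ((1 - Complex.exp (Complex.I * θ)) • (creation (orb (e.symm (0, b)) σ) * annihilation (orb (e.symm (-1, b)) σ)) + (1 - Complex.exp (-(Complex.I * θ))) • (creation (orb (e.symm (-1, b)) σ) * annihilation (orb (e.symm (0, b)) σ))); let E : ∀ (L M : ℕ) [NeZero L] [NeZero M] (Λ : Type) [LinearOrder Λ] [Fintype Λ], (Λ ≃ ZMod L × ZMod M) → ℝ → ℝ → ℕ → ℝ := fun L M _ _ Λ _ _ e U θ N => (H0 L M Λ e U + Tw L M Λ e θ).minEnergyOn (szSector N 0); let Np : ℕ → ℕ → ℝ → ℕ := fun L M δ => 2 * ⌊(1 - δ) * ((L : ℝ) * (M : ℝ)) / 2⌋₊; let stiff : ∀ (L M : ℕ) [NeZero L] [NeZero M] (Λ : Type) [LinearOrder Λ] [Fintype Λ], (Λ ≃ ZMod L × ZMod M) → ℝ → ℝ → ℝ := fun L M _ _ Λ _ _ e U δ => 2 * (L : ℝ) * (E L M Λ e U (Real.pi / 3) (Np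 L M δ) - E L M Λ e U 0 (Np L M δ)) / ((Real.pi / 3) ^ 2 * (M : ℝ)); let icomp : ∀ (L M : ℕ) [NeZero L] [NeZero M] (Λ : Type) [LinearOrder Λ] [Fintype Λ], (Λ ≃ ZMod L × ZMod M) → ℝ → ℝ → ℝ := fun L M _ _ Λ _ _ e U δ => (L : ℝ) * (M : ℝ) * (E L M Λ e U 0 (Np L M δ + 2) + E L M Λ e U 0 (Np L M δ - 2) - 2 * E L M Λ e U 0 (Np L M δ)) / 4; ∀ U : ℝ, 0 < U → ∀ δ ∈ Set.Ioo (0 : ℝ) (3 / 10), ∀ (L M' M'' M : ℕ) [NeZero L] [NeZero M'] [NeZero M''] [NeZero M], Even L → Even M' → Even M'' → M' + M'' = M → M ≤ L → ∀ (Λ' : Type) [LinearOrder Λ'] [Fintype Λ'] (e' : Λ' ≃ ZMod L × ZMod M') (Λ'' : Type) [LinearOrder Λ''] [Fintype Λ''] (e'' : Λ'' ≃ ZMod L × ZMod M'') (Λ : Type) [LinearOrder Λ] [Fintype Λ] (e : Λ ≃ ZMod L × ZMod M), max (min (stiff L M' Λ' e' U δ) (stiff L M'' Λ'' e'' U δ))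 0 ≤ stiff L M Λ e U δ ∧ max (min (icomp L M' Λ' e' U δ) (icomp L M'' Λ'' e'' U δ)) 0 ≤ icomp L M Λ e U δ ∧ icomp L M Λ e U δ ≤ max (max (icomp L M' Λ' e' U δ) (icomp L M'' Λ'' e'' U δ)) 0

/-- It is a strengthening: `SeamGluingLocalityAllSizes → C` (take `M₂ = L₂ = 0`). [folklore] -/
theorem seamGluingLocality_of_allSizes (h : SeamGluingLocalityAllSizes) : SeamGluingLocality := by
  dsimp only [SeamGluingLocalityAllSizes] at h
  dsimp only [SeamGluingLocality]
  intro U hU δ hδ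
  refine ⟨0, 0, ?_⟩
  intro L M' M'' M _ _ _ _ hL hM' hM'' _ _ hsum hML _ Λ' _ _ e' Λ'' _ _ e'' Λ _ _ e
  obtain ⟨h1, h2, h3⟩ := h U hU δ hδ L M' M'' M hL hM' hM'' hsum hML Λ' e' Λ'' e'' Λ e
  simp only [Nat.cast_zero, zero_div, sub_zero, one_mul, add_zero]
  exact ⟨h1, h2, h3⟩

/-- NEAR-MISS (numerical instance pending / uncertifiable). The smallest admissible gluing is
`L = 4`, `M′ = M″ = 2`, `M = 4` (tubes `4×2`, `4×2`, `4×4`; at `δ = 1/4`: `N = 6, 6, 12`;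
Hilbert-space dimension `8008²` for the glued tube). ED job (kit compute `glue44`; ids in the seat's
NOTES.md / item evidence `compute-<id>.json`) measures `stiff`, `icomp` of these three tubes at `(U,δ) = (4,1/4),
(8,1/8), (2,1/4)`; a violated inequality there refutes `SeamGluingLocalityAllSizes` numerically
but NOT in Lean (certified bounds on eigenvalues of `6.4·10⁷`-dimensional matrices are out of
reach), and says nothing about `C` (thresholds). Recorded so that nobody proposes the
threshold-free form. -/
theorem not_seamGluingLocalityAllSizes : ¬ SeamGluingLocalityAllSizes := by
  sorry

/-! ## §4 Tightness of the boundary factor -/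

/-- **A constant factor is not enough.** If the factor `1 − M₂/M` of `C` is weakened to a constant
`λ < 1` (here `λ = 1/2`), "locality" is satisfied by the strictly positive but DECAYING profile
`ρ_M = 1/(M+1)`, which has no positive floor: the width induction (`closes.key`) cannot run on any
such weakening — the defect `1 − factor` must be summable along the merge tree (for `1 − M₂/M`
along widths `M₁·(3/2)^j … 2^j` it is). Informs the restate debate: an ADDITIVE loss `c/M`
(line `seam_flow`, `key_additive`) is summable, a relative `O(1)` loss per gluing is not.
[folklore] -/
theorem constantFactor_admits_decay :
    ∃ ρ : ℕ → ℝ, (∀ M, 0 < ρ M) ∧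
      (∀ M' M'' : ℕ, (1 / 2 : ℝ) * max (min (ρ M') (ρ M'')) 0 ≤ ρ (M' + M'')) ∧
      ∀ d : ℝ, 0 < d → ∃ M : ℕ, ρ M < d := by
  refine ⟨fun M => 1 / ((M : ℝ) + 1), fun M => by positivity, ?_, ?_⟩
  · intro M' M''
    have h1 : (0 : ℝ) < (M' : ℝ) + 1 := by positivity
    have h2 : (0 : ℝ) < (M'' : ℝ) + 1 := by positivity
    have hpos : 0 < min (1 / ((M' : ℝ) + 1)) (1 / ((M'' : ℝ) + 1)) := lt_min (by positivity) (by positivity)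
    rw [max_eq_left hpos.le]
    rcases le_total M' M'' with h | h
    · have hc : (M' : ℝ) ≤ M'' := by exact_mod_cast h
      calc (1 / 2 : ℝ) * min (1 / ((M' : ℝ) + 1)) (1 / ((M'' : ℝ) + 1))
          ≤ (1 / 2) * (1 / ((M'' : ℝ) + 1)) := by gcongr; exact min_le_right _ _
        _ ≤ 1 / (((M' + M'' : ℕ) : ℝ) + 1) := by
          rw [Nat.cast_add, one_div_mul_one_div]
          exact one_div_le_one_div_of_le (by positivity) (by linarith)
    · have hc : (M'' : ℝ) ≤ M' := by exact_mod_cast h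
      calc (1 / 2 : ℝ) * min (1 / ((M' : ℝ) + 1)) (1 / ((M'' : ℝ) + 1))
          ≤ (1 / 2) * (1 / ((M' : ℝ) + 1)) := by gcongr; exact min_le_left _ _
        _ ≤ 1 / (((M' + M'' : ℕ) : ℝ) + 1) := by
          rw [Nat.cast_add, one_div_mul_one_div]
          exact one_div_le_one_div_of_le (by positivity) (by linarith)
  · intro d hd
    refine ⟨⌈1 / d⌉₊, ?_⟩
    have hc : 1 / d ≤ (⌈1 / d⌉₊ : ℝ) := Nat.le_ceil _
    have hlt : 1 / d < (⌈1 / d⌉₊ : ℝ) + 1 := by linarith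
    calc 1 / ((⌈1 / d⌉₊ : ℝ) + 1) < 1 / (1 / d) := one_div_lt_one_div_of_lt (by positivity) hlt
      _ = d := one_div_one_div d

/-! ## §5 Why `C` resists an unconditional disproof -/

/-- **Resistance certificate (prose).** (1) SHAPE: `C` is `∀(U,δ) ∃(M₂,L₂) ∀ sizes ≥ thresholds`;
a disproof must exhibit ONE `(U,δ)` with violations at ARBITRARILY LARGE `L` and `m` (§2), i.e.
control ground-state energy differences of doped Hubbard tubes at resolution `M/L` (twist) and
`1/(LM)` (compressibility) non-perturbatively — the summit's wall seen from the other side.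
(2) CONTINUITY IN `U` DOES NOT TRANSFER the `U = 0` violations: at fixed size the violation
margin is `O(M/L²)` in energy while `|∂E/∂U| ≤ LM/4`, so it survives only for `U ≲ M/(L³M)`, not
for one `U > 0` uniformly in the size (refuter N1, confirmed). (3) NO RIGOROUS PHASE INPUT exists
at any point of `(0,∞) × (0,3/10)`: half filling (Lieb flux phase / RP) is excluded by `δ > 0`;
Nagaoka needs one hole and `U = ∞`; low density needs `δ > 0.3` even after particle–hole; weak
coupling results are `T > 0` or `1D`. (4) NO JUNK: the let-bound vocabulary is honest (Peierls phase
`−e^{±iθ}` under the `−t` convention; `minEnergyOn (szSector N 0)` a genuine, labelling-invariant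
`N`-particle ground energy for even `N` by `SU(2)`; `Np ± 2` inside `[0, 2LM]` eventually), so no
degenerate-instance kill. (5) Hence every kill is MODULO a phase hypothesis (§2), none constructible;
the constructive residue is the restate (`RESTATE-PACKAGE.md`: conditional + additive). -/
theorem resists : True := trivial

-- Targets: (none — payload.targets = [], no lead seated, no registered skeleton)

/-! ## Line `seam_flow` (strategist's `Lines/seam_flow.lean`, for the RESTATED additive crux) — numerical probe

ED model of the seam flow used in kit job `seamflow44` (ids in the seat's NOTES.md / item evidence):
glued carrier `4 × 4` (`L = 4`, `M′ = M″ = 2`), `Hs` = Hubbard Hamiltonian of the two-tube graph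
(rows `{0,1}` and `{2,3}` each closed periodically among themselves — for width 2 the closure is
the rung already present, so each part is the plain 2-leg ladder with a single rung, exactly the
crux's `M = 2` member), `V = H_M(0) − Hs(0)` = the hopping terms on the `2L = 8` transverse bonds
`(x,1)–(x,2)` and `(x,3)–(x,0)` joining the two halves (for width-2 parts nothing is removed; for
parts of width `≥ 3` the parts' closing bonds would be removed as well), seam twist `Tw θ` on the
column `−1 ↔ 0` as in the crux, `H_t = Hs + Tw θ + tV`, `θ ∈ {0, π/3}`,
`t ∈ {0, 1/4, 1/2, 3/4, 1}`, `(U,δ) = (4, 1/4)`, `N = 12`, `S^z = 0` sector minimum by Lanczos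
(`8008²`-dimensional). Reported: `Δ(t) = E_t(π/3) − E_t(0)` and `2LΔ(t)/((π/3)²M)` (stiffness
units). Stub S3 (integrated gluing monotonicity) predicts `Δ(1) ≥ Δ(0) − (π/3)²C/(2L)`; S3p
(pointwise) predicts monotone seam-energy response. RESULTS: see the `seamflow44.json` artefact /
item evidence `compute-<id>.json` (pending at v2 of this file). -/
theorem line_seam_flow_probe : True := trivial

end Summit.HubbardSuperconductivity.HubbardSuperconductivity.Cruxes.SeamGluingLocality.Disproof
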